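import Literature.NumberTheory.EllipticCurves.RootNumberTableThree
import HarnessLib

/-!
# The untwisted trace `a_w(E)` on the principal-series rows at `3` — DEFINITION in Kraus/Rizzo currency
# (route `CyclotomicUntwist`, cruxes K1 `PSRankOneLowerHalfAtThree` / K2 `PSRankOneUpperHalfAtThree`)

Cell `pub/bsd-wall` (D-0145 line `route-BirchSwinnertonDyer-CyclotomicUntwist`), seat `bsd-line-cycu-p3` (gen 6).
Route-posited DEFINITIONS file (`--supports stmt-BirchSwinnertonDyer-21580 --as helper`). Nothing is asserted about
newforms, `L`-functions or BSD; no named fact; no `sorry`. BSD is not proved by this file and no crux is.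

WHAT IS DEFINED. For a Weierstrass equation over `ℚ` with invariants `c₆, Δ` put `v := v₃(Δ)`,
`c₆' := c₆/3^{v₃ c₆}` and `Δ′ := Δ/3^{v}` read modulo `9` (Rizzo's `res9`, the currency of the tree's Table-II
transcription `RootNumberTableThree`). The integer

* `v ≡ 4 (mod 12)`:  `a_w := 3 · s(c₆') · e(Δ′)`,   `v ≡ 10 (mod 12)`:  `a_w := −3 · s(c₆') · e(Δ′)`,
* `v ≡ 6 (mod 12)`:  `a_w := T(c₆')`,               `v ≡ 0 (mod 12)`:   `a_w := −T(c₆')`,   otherwise `0`,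

where `s(4) = 1`, `s(5) = −1` (`signNine`), `e(4) = 1`, `e(7) = 0`, `e(1) = −1` (`epsNine`) and
`T(1) = T(2) = −3`, `T(4) = T(5) = 0`, `T(7) = T(8) = 3` (`traceTableIV`), all other residues giving `0`, is
`untwistedTraceOfInvariants c₆ Δ`; for `W : WeierstrassCurve ℚ` we set
`W.psUntwistedTrace := untwistedTraceOfInvariants W.c₆ W.Δ` (any equation of the curve may be used: a rescaling
`u = 3ᵏu₀` shifts `v` by `12k` and multiplies `c₆', Δ′` by `u₀⁻⁶ ≡ u₀⁻¹² ≡ 1 (mod 9)`).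

WHAT IT MEANS (informal; NOT asserted anywhere in the tree). On the principal-series rows of K1/K2 (`E/ℚ` with
wild additive potentially good reduction at `3` of Kraus type `C₃`/`C₆`, `v₃(Δ_min) ∈ {4, 6, 10, 12}`, and
`Δ_min ∈ (ℚ₃ˣ)²`, i.e. `Δ′ ≡ 1 (mod 3)`) the curve acquires good supersingular reduction over the totally ramified
sextic field `ℚ₃(ζ₉)` (tree: `TypeGNine`, `stub_gNineCriterion` ✓), with special fibre `Ē_w : y² = x³ − x + b̄` over
`𝔽₃` (`CyclotomicUntwistGNineSpecialFibre`, p610052) and Frobenius trace `a_w(E) := 3 + 1 − #Ē_w(𝔽₃) = −3·b̄ ∈ {0, ±3}`.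
LAW L-a3 of the crux memo `Cruxes/PSRankOneLowerHalfAtThree/LAW-La3-KERNEL-v3.md` (cycu-p3 g5): (T) by
Néron–Ogg–Shafarevich, Atkin–Li and Carayol's `ℓ ≠ p` local–global compatibility, `a_w(E) = a₃(g) + a₃(ḡ)` and
`a₃(g)·a₃(ḡ) = 3` for the UNTWIST `g = (f_E ⊗ η̄)^{new}` of level `9M` — so D1's free parameter `α = a₃(g)`
(`IsPSCyclotomicLFunctionOf W η α 𝓛`) is a root of `X² − a_w(E)·X + 3`; (N) the closed form above computes `a_w(E)`
from the minimal model. The reformulation (N′) used here (only `v mod 12`, `c₆' mod 9`, `Δ′ mod 9`; the `c₄`-digit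
of (N) is traded for `Δ′ mod 9` through the `c`-relation `c₄'³ − c₆'² = 192·Δ′` on the `II`/`IV*` rows) was
checked against the Tate-algorithm recipe of `GNINE-RECIPES-v1` (cycu-p1) on ALL 24 420 principal-series curves
(21 044 isogeny classes, every rank) of conductor `< 500 000` in Cremona's table: 0 exceptions, `a_w` constant on
isogeny classes (session folder `work/num/aw_check.py`, < 2 cpu-s). The intrinsic clause `α² − a_w(W)·α + 3 = 0` is
the admissibility binder of the separated K1 ∧ K2 closer `psRankOne_halves_of_separated_pin_intrinsic`
(`CyclotomicUntwistFiniteSlopeSeparatedPinnedIntrinsic`, cycu-p5 g6, p614028), where the trace is a PARAMETER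
`aw : WeierstrassCurve ℚ → ℤ`; this file supplies the intended term `fun W ↦ W.psUntwistedTrace`.

JUNK VALUES (documented): `0` off the four residue classes of `v mod 12`, and whenever `c₆' mod 9 ∉ {4, 5}` on the
`v ≡ 4, 10` branches (on the PS rows `c₆' ≡ ±4 (mod 9)` is forced there) — nothing reads the value off the PS rows.
The `v ≡ 0 (mod 12)` branch also fires at good reduction (`v = 0`): junk, unread.

Contents: `signNine`, `epsNine`, `traceTableIV`, `untwistedTraceOfInvariants`, `WeierstrassCurve.psUntwistedTrace`
(deliberate dot-notation extension of Mathlib's `WeierstrassCurve` namespace, as `rootNumberThree`), and the trivial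
API: branch lemmas, `a_w ∈ {0, ±3}`, `3 ∣ a_w`, `|a_w| ≤ 3`. No `instance`, no `notation`.

References: A. Kraus, Manuscripta Math. 69 (1990) 353–385, Théorème (p = 3) [Kraus1990]; J. Tate, *Algorithm for
determining the type of a singular fiber in an elliptic pencil*, LNM 476 (1975) §7 [Tate1975]; O. G. Rizzo, Compositio
Math. 136 (2003), §1.1–1.2 (the `x'`, `res9` currency) [Rizzo2003]; H. Carayol, Ann. Sci. ÉNS 19 (1986) 409–468
[Carayol1986]; A. O. L. Atkin, W.-C. W. Li, Invent. Math. 48 (1978), Thm. 3.1 [AtkinLi1978]; B. Mazur, J. Tate,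
J. Teitelbaum, Invent. Math. 84 (1986), §I.14 (case `p ∣ N`, `a_p ≠ 0`) [MazurTateTeitelbaum1986Invent];
J.-P. Serre, J. Tate, Ann. of Math. 88 (1968), §2 [SerreTate1968].
-/

set_option autoImplicit false
-- single-conjunct summit: `Summit.BirchSwinnertonDyer.BirchSwinnertonDyer.…` repeats the name by design
set_option linter.dupNamespace false

open Literature.NumberTheory.EllipticCurves

namespace Summit.BirchSwinnertonDyer.BirchSwinnertonDyer.Theorems.PSUntwistedTrace

/-! ### The three residue tables -/

/-- The sign `s(c₆')` of LAW L-a3 (N′) on the Kodaira `II`/`IV*` rows, read on `c₆' mod 9 ∈ {0,…,8}`: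
`4 ↦ +1`, `5 ↦ −1`, every other residue `↦ 0` (junk: on those rows `c₆' ≡ ±4 (mod 9)`).
[cite: Kraus1990, Théorème (p = 3)] -/
def signNine (r : ℤ) : ℤ :=
  if r = 4 then 1 else if r = 5 then -1 else 0

/-- The `Δ′`-digit `e(Δ′)` of LAW L-a3 (N′) on the Kodaira `II`/`IV*` rows, read on `Δ′ mod 9`: `4 ↦ +1`, `7 ↦ 0`,
`1 ↦ −1`, every other residue `↦ 0` (junk: on the principal-series rows `Δ′ ≡ 1 (mod 3)`). It encodes
`⟨1 − (Δ′ − 4)/3⟩ ∈ {−1, 0, 1}`. [cite: Kraus1990, Théorème (p = 3)] -/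
def epsNine (r : ℤ) : ℤ :=
  if r = 4 then 1 else if r = 1 then -1 else 0

/-- The table `T(c₆')` of LAW L-a3 (N′) on the Kodaira `IV` rows (`v₃Δ = 6`), read on `c₆' mod 9`:
`1, 2 ↦ −3`, `4, 5 ↦ 0`, `7, 8 ↦ +3`, every other residue `↦ 0` (junk: `3 ∤ c₆'`). On the `II*` rows (`v₃Δ = 12`)
the trace is `−T(c₆')`. [cite: Kraus1990, Théorème (p = 3)] [cite: Tate1975, §7] -/
def traceTableIV (r : ℤ) : ℤ :=
  if r = 1 ∨ r = 2 then -3 else if r = 7 ∨ r = 8 then 3 else 0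

/-- `s(r) ∈ {−1, 0, 1}`. [folklore] -/
theorem signNine_eq_or (r : ℤ) : signNine r = 0 ∨ signNine r = 1 ∨ signNine r = -1 := by
  unfold signNine; split_ifs <;> simp

/-- `e(r) ∈ {−1, 0, 1}`. [folklore] -/
theorem epsNine_eq_or (r : ℤ) : epsNine r = 0 ∨ epsNine r = 1 ∨ epsNine r = -1 := by
  unfold epsNine; split_ifs <;> simp

/-- `T(r) ∈ {−3, 0, 3}`. [folklore] -/
theorem traceTableIV_eq_or (r : ℤ) : traceTableIV r = 0 ∨ traceTableIV r = 3 ∨ traceTableIV r = -3 := by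
  unfold traceTableIV; split_ifs <;> simp

/-! ### The untwisted trace from the invariants of any equation over `ℚ` -/

/-- **LAW L-a3 (N′), the untwisted trace from `(c₆, Δ)`.** With `v = v₃(Δ)` and Rizzo's residues
`res9 c₆ = c₆' mod 9`, `res9 Δ = Δ′ mod 9`: `3·s(c₆')·e(Δ′)` if `v ≡ 4 (12)`, `−3·s(c₆')·e(Δ′)` if `v ≡ 10 (12)`,
`T(c₆')` if `v ≡ 6 (12)`, `−T(c₆')` if `v ≡ 0 (12)`, and `0` otherwise (junk off the principal-series rows;
module docstring). Intended meaning (informal, not asserted): the Frobenius trace of the good special fibre of the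
curve over `ℚ₃(ζ₉)`, `= a₃(g) + a₃(ḡ)` for the untwist `g` of the route.
[cite: Kraus1990, Théorème (p = 3)] [cite: Tate1975, §7] [cite: Rizzo2003, §1.1–1.2 (notation x')] -/
def untwistedTraceOfInvariants (c₆ Δ : ℚ) : ℤ :=
  if padicValRat 3 Δ % 12 = 4 then 3 * signNine (Rizzo.res9 c₆) * epsNine (Rizzo.res9 Δ)
  else if padicValRat 3 Δ % 12 = 10 then -3 * signNine (Rizzo.res9 c₆) * epsNine (Rizzo.res9 Δ)
  else if padicValRat 3 Δ % 12 = 6 then traceTableIV (Rizzo.res9 c₆)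
  else if padicValRat 3 Δ % 12 = 0 then -traceTableIV (Rizzo.res9 c₆)
  else 0

/-- Branch `v₃Δ ≡ 4 (mod 12)` (Kodaira `II` on a minimal equation): `a_w = 3·s(c₆')·e(Δ′)`.
[cite: Kraus1990, Théorème (p = 3)] -/
theorem untwistedTraceOfInvariants_of_four {c₆ Δ : ℚ} (h : padicValRat 3 Δ % 12 = 4) :
    untwistedTraceOfInvariants c₆ Δ = 3 * signNine (Rizzo.res9 c₆) * epsNine (Rizzo.res9 Δ) := by
  simp [untwistedTraceOfInvariants, h]

/-- Branch `v₃Δ ≡ 10 (mod 12)` (Kodaira `IV*`): `a_w = −3·s(c₆')·e(Δ′)`. [cite: Kraus1990, Théorème (p = 3)] -/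
theorem untwistedTraceOfInvariants_of_ten {c₆ Δ : ℚ} (h : padicValRat 3 Δ % 12 = 10) :
    untwistedTraceOfInvariants c₆ Δ = -3 * signNine (Rizzo.res9 c₆) * epsNine (Rizzo.res9 Δ) := by
  simp [untwistedTraceOfInvariants, h]

/-- Branch `v₃Δ ≡ 6 (mod 12)` (Kodaira `IV`): `a_w = T(c₆')`. [cite: Kraus1990, Théorème (p = 3)] -/
theorem untwistedTraceOfInvariants_of_six {c₆ Δ : ℚ} (h : padicValRat 3 Δ % 12 = 6) :
    untwistedTraceOfInvariants c₆ Δ = traceTableIV (Rizzo.res9 c₆) := by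
  simp [untwistedTraceOfInvariants, h]

/-- Branch `v₃Δ ≡ 0 (mod 12)` (Kodaira `II*` on a minimal equation with `v₃Δ = 12`): `a_w = −T(c₆')`.
[cite: Kraus1990, Théorème (p = 3)] -/
theorem untwistedTraceOfInvariants_of_twelve {c₆ Δ : ℚ} (h : padicValRat 3 Δ % 12 = 0) :
    untwistedTraceOfInvariants c₆ Δ = -traceTableIV (Rizzo.res9 c₆) := by
  simp [untwistedTraceOfInvariants, h]

/-- **`a_w ∈ {0, 3, −3}`** for every input (every branch is `±3·{−1,0,1}·{−1,0,1}`, `±T`, or `0`). [folklore] -/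
theorem untwistedTraceOfInvariants_eq_or (c₆ Δ : ℚ) :
    untwistedTraceOfInvariants c₆ Δ = 0 ∨ untwistedTraceOfInvariants c₆ Δ = 3 ∨
      untwistedTraceOfInvariants c₆ Δ = -3 := by
  unfold untwistedTraceOfInvariants
  rcases signNine_eq_or (Rizzo.res9 c₆) with hs | hs | hs <;>
    rcases epsNine_eq_or (Rizzo.res9 Δ) with he | he | he <;>
      rcases traceTableIV_eq_or (Rizzo.res9 c₆) with ht | ht | ht <;>
        simp only [hs, he, ht] <;> split_ifs <;> norm_num

/-- **`3 ∣ a_w`** — the divisibility guard of `admissible_consequences` /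
`psRankOne_halves_of_separated_pin_intrinsic` (`CyclotomicUntwistFiniteSlopeSeparatedPinnedIntrinsic`). [folklore] -/
theorem three_dvd_untwistedTraceOfInvariants (c₆ Δ : ℚ) : (3 : ℤ) ∣ untwistedTraceOfInvariants c₆ Δ := by
  rcases untwistedTraceOfInvariants_eq_or c₆ Δ with h | h | h <;> rw [h] <;> norm_num

/-- `|a_w| ≤ 3` (so with `3 ∣ a_w`: `a_w ∈ {0, ±3}`, the Hasse range of a trace over `𝔽₃` divisible by `3`).
[folklore] -/
theorem natAbs_untwistedTraceOfInvariants_le (c₆ Δ : ℚ) :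
    (untwistedTraceOfInvariants c₆ Δ).natAbs ≤ 3 := by
  rcases untwistedTraceOfInvariants_eq_or c₆ Δ with h | h | h <;> rw [h] <;> norm_num

/-! ### On a Weierstrass equation over `ℚ` -/

/-- **`W.psUntwistedTrace`, the untwisted trace `a_w` of the curve of `W/ℚ` AS GIVEN BY LAW L-a3 (N′)** on the
invariants `c₆, Δ` of the equation `W` (any equation over `ℚ`; module docstring). On the principal-series rows of
the route `CyclotomicUntwist` this is (informally; not asserted) the Frobenius trace `3 + 1 − #Ē_w(𝔽₃) ∈ {0, ±3}` of
the good special fibre over `ℚ₃(ζ₉)` and the trace `a₃(g) + a₃(ḡ)` of the untwisted `U₃`-eigenvalue pair; elsewhere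
junk. Deliberate dot-notation extension of Mathlib's `WeierstrassCurve` namespace (as `rootNumberThree`).
[cite: Kraus1990, Théorème (p = 3)] [cite: MazurTateTeitelbaum1986Invent, §I.14] [cite: Carayol1986, Thm. (A)]
[cite: AtkinLi1978, Thm. 3.1] -/
def _root_.WeierstrassCurve.psUntwistedTrace (W : WeierstrassCurve ℚ) : ℤ :=
  untwistedTraceOfInvariants W.c₆ W.Δ

/-- Unfolding `psUntwistedTrace` (definitional). [folklore] -/
theorem psUntwistedTrace_def (W : WeierstrassCurve ℚ) :
    W.psUntwistedTrace = untwistedTraceOfInvariants W.c₆ W.Δ := rfl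

/-- **`a_w(W) ∈ {0, 3, −3}`.** [folklore] -/
theorem psUntwistedTrace_eq_or (W : WeierstrassCurve ℚ) :
    W.psUntwistedTrace = 0 ∨ W.psUntwistedTrace = 3 ∨ W.psUntwistedTrace = -3 :=
  untwistedTraceOfInvariants_eq_or W.c₆ W.Δ

/-- **`3 ∣ a_w(W)`** for every `W` — discharges the hypothesis `3 ∣ aw W` of
`CyclotomicUntwistFiniteSlopeSeparatedPinnedIntrinsic.admissible_consequences` at `aw := psUntwistedTrace`. [folklore] -/
theorem three_dvd_psUntwistedTrace (W : WeierstrassCurve ℚ) : (3 : ℤ) ∣ W.psUntwistedTrace :=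
  three_dvd_untwistedTraceOfInvariants W.c₆ W.Δ

/-- `|a_w(W)| ≤ 3`. [folklore] -/
theorem natAbs_psUntwistedTrace_le (W : WeierstrassCurve ℚ) : W.psUntwistedTrace.natAbs ≤ 3 :=
  natAbs_untwistedTraceOfInvariants_le W.c₆ W.Δ

/-- `a_w(W)² ∈ {0, 9}`, equivalently `a_w² = 3·|a_w|`: the discriminant `a_w² − 12` of `X² − a_w X + 3` is `−12`
or `−3`, never a square — both roots are non-real quadratic over `ℚ` (slope `½` at `3`). [folklore] -/
theorem psUntwistedTrace_sq_eq_or (W : WeierstrassCurve ℚ) :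
    W.psUntwistedTrace ^ 2 = 0 ∨ W.psUntwistedTrace ^ 2 = 9 := by
  rcases psUntwistedTrace_eq_or W with h | h | h <;> rw [h] <;> norm_num

end Summit.BirchSwinnertonDyer.BirchSwinnertonDyer.Theorems.PSUntwistedTrace
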